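import Summits.ResolutionOfSingularities.ResolutionOfSingularities.Theorems.PurelyInseparableDim4WinCertAllFieldsScope
import HarnessLib
import HarnessLib.Audit.Tags

/-!
# Purely inseparable fourfolds — win certificates over every field, v2: INERT coordinates need no witness
# [OURS · counted 0 · a certificate format for OUR frame v4, not about resolution]

Census cell «res-dim4-pi» (D-0157 DOOR 2), width seat `res-dim4-p-14` (generation 2); refines
`…WinCertAllFields` / `…WinCertAllFieldsScope` (p666074 / p667696).  There a row is accepted only if, in every chart
`j ∈ S`, EVERY coordinate `i ≠ j` is rationality-forced.  That is too strict: if the variable `x_i` does not occur in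
the chart transform `G` at all (an **INERT coordinate** — e.g. `x₁` for the band root `x₂x₃x₄`), player B may move `b_i`
anywhere in `K`, but the translated polynomial does not see `b_i`, so the child STATE is the one of the `𝔽_p`-reply
with `b_i` replaced by `0` or `1` (the bookkeeping `r`, `exc` only asks whether `b_i = 0`).  This file:
* `inertB i G` (no term of `G` mentions `x_i`) and **`translate_map_congr`**: replies that agree on the non-inert
  coordinates give the same translated chart transform; `step_congr` / `isEquimultiplePoint_congr` (same translated
  transform ∧ same zero pattern ⇒ same `CentreBlowup.step` and same equimultiplicity);
* `ratOK2` = for every `j ∈ S` and `i ≠ j`: `x_i` inert in `chartL q S j L` OR a rationality witness (`ratWitB`);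
  **`exists_reply_of_ratOK2`**: every equimultiple `K`-reply `b` has an `𝔽_p`-reply `b₀` with the same step and the
  same equimultiplicity;
* the in-scope format v2 `uirowOK2` / `uiwinCertB2 p q` on `UICert` rows (PR-12u rows + witnesses; `.mono` blind leaves
  as in `…Scope`) and **`inScopeStateWins_map_of_uiwinCertB2`** / `forall_inScopeStateWins_of_uiwinCertB2`: every row
  state `⊗ K` is IN-SCOPE ESCAPABLE over every field `K` of characteristic `p`;
* acceptance (`decide`): the band root `x₂x₃x₄` (`r = 0`, `exc = ∅`) — planes `V(x₂,x₃)` then `V(x₃,x₄)`/`V(x₂,x₄)`,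
  absent variables inert, present ones forced ⇒ `forall_inScopeStateWins_x234U`: escapable over EVERY field of
  characteristic 2, which v1 could not certify (no centre of this root has all coordinates forced).
Nothing here proves resolution of singularities in dimension ≥ 4 / characteristic `p`; counted 0; AI work, weaker
than expert review.  bears_on: LADDER-RESOLUTION:D157-DOOR2 (res-dim4-pi · F4-C instrument · ∀K gap).
Supports stmt-ResolutionOfSingularities-16155 (helper).
-/

set_option linter.dupNamespace false

noncomputable section
open MvPolynomial Finset
open scoped BigOperators
namespace Summit.ResolutionOfSingularities.ResolutionOfSingularities.Theorems.PIDim4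

namespace WinCertAllFields

open Literature.AlgebraicGeometry.Resolution
open Literature.AlgebraicGeometry.Resolution.CentreBlowup
open StepKit WinCertSound InScopeWinCert ScopeCover ScopeBlind

variable {k : Type} [Field k] [DecidableEq k]

/-! ## 1. Inert coordinates -/

/-- `x_i` is INERT for the term list `G`: no term mentions it. [folklore] -/
def inertB (i : Fin 4) (G : Terms 4 k) : Bool := G.all fun t => decide (t.1 i = 0)

/-- `translate` is additive. [folklore] -/
theorem translate_add' {K : Type} [Field K] (b : Fin 4 → K) (P Q : MvPolynomial (Fin 4) K) :
    PointBlowup.translate b (P + Q) = PointBlowup.translate b P + PointBlowup.translate b Q := by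
  unfold PointBlowup.translate
  rw [map_add]

/-- `translate` on a monomial: `c · ∏ (x_l + b_l)^{e_l}`. [folklore] -/
theorem translate_monomial_expo {K : Type} [Field K] (b : Fin 4 → K) (e : Fin 4 → ℕ) (c : K) :
    PointBlowup.translate b (monomial (expo e) c) = C c * ∏ l, (X l + C (b l)) ^ e l := by
  unfold PointBlowup.translate
  rw [monomial_expo_eq, map_mul, MvPolynomial.algHom_C, MvPolynomial.algebraMap_eq, map_prod]
  simp only [map_pow, MvPolynomial.aeval_X]

omit [DecidableEq k] in
/-- Replies that agree wherever the variable occurs translate `G ⊗ K` identically. [folklore] -/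
theorem translate_map_congr {K : Type} [Field K] (f : k →+* K) {b b' : Fin 4 → K} :
    ∀ (G : Terms 4 k), (∀ l, inertB l G = true ∨ b l = b' l) →
      PointBlowup.translate b (MvPolynomial.map f (evalT G)) =
        PointBlowup.translate b' (MvPolynomial.map f (evalT G))
  | [], _ => by
    rw [evalT_nil, map_zero]
    unfold PointBlowup.translate
    rw [map_zero, map_zero]
  | t :: rest, h => by
    have hrest : ∀ l, inertB l rest = true ∨ b l = b' l := fun l => by
      rcases h l with hl | hl
      · left; unfold inertB at hl ⊢; rw [List.all_cons, Bool.and_eq_true] at hl; exact hl.2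
      · exact Or.inr hl
    have ht : ∀ l, t.1 l = 0 ∨ b l = b' l := fun l => by
      rcases h l with hl | hl
      · left; unfold inertB at hl; rw [List.all_cons, Bool.and_eq_true] at hl; exact of_decide_eq_true hl.1
      · exact Or.inr hl
    rw [evalT_cons, map_add, translate_add', translate_add', translate_map_congr f rest hrest, map_monomial,
      translate_monomial_expo, translate_monomial_expo]
    congr 2
    refine Finset.prod_congr rfl fun l _ => ?_
    rcases ht l with hl | hl
    · rw [hl, pow_zero, pow_zero]
    · rw [hl]

omit [DecidableEq k] in
/-- Same translated chart transform and same zero pattern ⇒ same step and same equimultiplicity. [folklore] -/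
theorem step_congr {K : Type} [Field K] [DecidableEq K] {q : ℕ} {S : Finset (Fin 4)} {j : Fin 4}
    {b b' : Fin 4 → K} (s : State K)
    (hT : PointBlowup.translate b (chartTransform q S j s.F) = PointBlowup.translate b' (chartTransform q S j s.F))
    (hz : ∀ l, b l = 0 ↔ b' l = 0) :
    step q S j b s = step q S j b' s ∧ (IsEquimultiplePoint q S j b s ↔ IsEquimultiplePoint q S j b' s) := by
  have hpt : pointTransform q S j b s = pointTransform q S j b' s := hT
  have hr : newMult q S j b s = newMult q S j b' s := by
    unfold newMult
    have : (s.r.filter fun i => b i = 0) = s.r.filter fun i => b' i = 0 := by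
      ext i
      rw [Finsupp.filter_apply, Finsupp.filter_apply]
      by_cases h : b i = 0
      · rw [if_pos h, if_pos ((hz i).mp h)]
      · rw [if_neg h, if_neg (fun h' => h ((hz i).mpr h'))]
    rw [this]
  have he : newExc j b s = newExc j b' s := by
    unfold newExc
    rw [Finset.filter_congr (fun i _ => hz i)]
  refine ⟨?_, ?_⟩
  · unfold step
    rw [hpt, hr, he]
  · unfold IsEquimultiplePoint
    rw [hpt]

/-! ## 2. The v2 rationality check: inert OR forced -/

/-- **Rationality check v2**: for every chart `j ∈ S` and every `i ≠ j`, `x_i` is inert in the chart transform or a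
rationality witness passes. [folklore] -/
def ratOK2 (p q : ℕ) (row : URow k) : Bool :=
  decide (∀ j ∈ row.1.2, ∀ i : Fin 4, i ≠ j →
    inertB i (chartL q row.1.2 j row.1.1.L) = true ∨
      ∃ w ∈ row.2, w.j = j ∧ w.i = i ∧ ratWitB p q (chartL q row.1.2 j row.1.1.L) w = true)

/-- v1 rows pass v2. [folklore] -/
theorem ratOK2_of_ratOK {p q : ℕ} {row : URow k} (h : ratOK p q row = true) : ratOK2 p q row = true := by
  unfold ratOK at h
  unfold ratOK2
  rw [decide_eq_true_eq] at h ⊢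
  exact fun j hj i hij => Or.inr (h j hj i hij)

/-- **Every equimultiple `K`-reply has an `𝔽_p`-reply with the same step and the same equimultiplicity** (for a row
passing `ratOK2`): inert coordinates are replaced by `0`/`1` according to whether `b_i = 0`, forced ones are rational.
[folklore] -/
theorem exists_reply_of_ratOK2 {p : ℕ} [Fact p.Prime] {q : ℕ} {K : Type} [Field K] [CharP K p] [DecidableEq K]
    (f : ZMod p →+* K) {row : URow (ZMod p)} (hrat : ratOK2 p q row = true) {j : Fin 4} (hj : j ∈ row.1.2)
    {b : Fin 4 → K} (hbj : b j = 0)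
    (heq : IsEquimultiplePoint q row.1.2 j b
      (⟨MvPolynomial.map f row.1.1.toState.F, row.1.1.toState.r, row.1.1.toState.exc⟩ : State K)) :
    ∃ b₀ : Fin 4 → ZMod p, b₀ j = 0 ∧
      step q row.1.2 j b (⟨MvPolynomial.map f row.1.1.toState.F, row.1.1.toState.r, row.1.1.toState.exc⟩ : State K) =
        step q row.1.2 j (f ∘ b₀)
          (⟨MvPolynomial.map f row.1.1.toState.F, row.1.1.toState.r, row.1.1.toState.exc⟩ : State K) ∧
      IsEquimultiplePoint q row.1.2 j (f ∘ b₀)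
        (⟨MvPolynomial.map f row.1.1.toState.F, row.1.1.toState.r, row.1.1.toState.exc⟩ : State K) := by
  unfold ratOK2 at hrat
  have hall := of_decide_eq_true hrat
  set G := chartL q row.1.2 j row.1.1.L with hG
  -- per coordinate: a rational value with the right zero pattern, equal to `b i` unless `x_i` is inert
  have hcoord : ∀ i : Fin 4, ∃ c : ZMod p, (b i = 0 ↔ f c = 0) ∧ (inertB i G = true ∨ f c = b i) := by
    intro i
    by_cases hij : i = j
    · exact ⟨0, by rw [map_zero, hij, hbj], Or.inr (by rw [map_zero, hij, hbj])⟩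
    · rcases hall j hj i hij with hin | ⟨w, -, hwj, hwi, hw⟩
      · by_cases hb0 : b i = 0
        · exact ⟨0, by rw [map_zero, hb0], Or.inl hin⟩
        · exact ⟨1, by rw [map_one]; exact ⟨fun h => absurd h hb0, fun h => absurd h one_ne_zero⟩, Or.inl hin⟩
      · have hpow := pow_eq_zero_of_ratWitB hw f b (by rw [hwj]; exact hbj)
          (fun α h0 hq => eval₂Hom_hasseDeriv_eq_zero_of_isEquimultiplePoint f row.1.1 heq α h0 hq)
        rw [hwi] at hpow
        obtain ⟨c, hc⟩ := exists_eq_cast_of_pow_eq_zero f hpow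
        exact ⟨c, by rw [hc], Or.inr hc⟩
  choose b₀ hb₀ using hcoord
  have hz : ∀ l, b l = 0 ↔ (f ∘ b₀) l = 0 := fun l => (hb₀ l).1
  have hagree : ∀ l, inertB l G = true ∨ b l = (f ∘ b₀) l := fun l => by
    rcases (hb₀ l).2 with h | h
    · exact Or.inl h
    · exact Or.inr h.symm
  have hT : PointBlowup.translate b (chartTransform q row.1.2 j (MvPolynomial.map f row.1.1.toState.F)) =
      PointBlowup.translate (f ∘ b₀) (chartTransform q row.1.2 j (MvPolynomial.map f row.1.1.toState.F)) := by
    rw [SData.toState_F, chartTransform_map, chartTransform_evalT]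
    exact translate_map_congr f G hagree
  obtain ⟨hstep, hequi⟩ := step_congr
    (⟨MvPolynomial.map f row.1.1.toState.F, row.1.1.toState.r, row.1.1.toState.exc⟩ : State K) hT hz
  refine ⟨b₀, ?_, hstep, hequi.mp heq⟩
  have h0 : f (b₀ j) = 0 := by
    have := (hz j).mp hbj
    exact this
  exact (map_eq_zero_iff f f.injective).mp h0

/-! ## 3. The in-scope format v2 and its soundness over every field -/

variable [Fintype k]

/-- The v2 row check: `.mono` BLIND leaf, or origin not `q`-fold, or PR-12u's move check over `k` with `ratOK2`.
[folklore] -/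
def uirowOK2 (p q : ℕ) (rest : UICert k) (row : UIRow k) : Bool :=
  monoBlindOK q row || !(permB q Finset.univ row.1.1.L) ||
    ((permB q row.1.2.1 row.1.1.L &&
      decide (∀ j ∈ row.1.2.1, ∀ b : Fin 4 → k, b j = 0 →
        ireplyOK q (rest.map Prod.fst) row.1.1 row.1.2.1 j b = true)) &&
      ratOK2 p q ((row.1.1, row.1.2.1), row.2))

/-- **The v2 checker.** [folklore] -/
def uiwinCertB2 (p q : ℕ) : UICert k → Bool
  | [] => true
  | row :: rest => uirowOK2 p q rest row && uiwinCertB2 p q rest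

/-- **SOUNDNESS of one v2 row over `K`.** [folklore] -/
theorem inScopeStateWins_map_of_uirowOK2 {p : ℕ} [Fact p.Prime] {q : ℕ} {K : Type} [Field K] [CharP K p]
    [DecidableEq K] (f : ZMod p →+* K) {rest : UICert (ZMod p)}
    (hrest : ∀ r ∈ rest, InScopeStateWins q
      (⟨MvPolynomial.map f r.1.1.toState.F, r.1.1.toState.r, r.1.1.toState.exc⟩ : State K))
    {row : UIRow (ZMod p)} (h : uirowOK2 p q rest row = true) :
    InScopeStateWins q
      (⟨MvPolynomial.map f row.1.1.toState.F, row.1.1.toState.r, row.1.1.toState.exc⟩ : State K) := by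
  unfold uirowOK2 at h
  rw [Bool.or_eq_true, Bool.or_eq_true] at h
  rcases h with (hb | ht) | hm
  · unfold monoBlindOK at hb
    obtain ⟨⟨s, S, oβ⟩, ws⟩ := row
    rcases oβ with _ | ⟨c, w, α₀, a⟩ | ⟨P, v, D, kk, α₀, a⟩
    · exact absurd hb Bool.false_ne_true
    · exact inScopeStateWins_of_not_inCoordinateScope (not_inCoordinateScope_map_of_blindB f hb)
    · exact absurd hb Bool.false_ne_true
  · rw [Bool.not_eq_true'] at ht
    refine inScopeStateWins_of_no_permissible fun S hS => ?_
    exact no_permissible_of_not_permB ht S ((BaseChange.isPermissibleCentre_map_iff f q S _).mp hS)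
  · rw [Bool.and_eq_true, Bool.and_eq_true, decide_eq_true_eq] at hm
    obtain ⟨⟨hS, hall⟩, hrat⟩ := hm
    have hperm : IsPermissibleCentre q row.1.2.1 row.1.1.toState.F :=
      (isPermissibleCentre_iff q row.1.2.1 row.1.1.L).mpr hS
    refine inScopeStateWins_move row.1.2.1 ((BaseChange.isPermissibleCentre_map_iff f q row.1.2.1 _).mpr hperm) ?_
    rintro s' ⟨j, b, hj, hbj, heq, hne, rfl⟩
    obtain ⟨b₀, hb₀j, hstep, heq'⟩ :=
      exists_reply_of_ratOK2 f (row := ((row.1.1, row.1.2.1), row.2)) hrat hj hbj heq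
    have heq₀ : IsEquimultiplePoint q row.1.2.1 j b₀ row.1.1.toState :=
      (BaseChange.isEquimultiplePoint_map_ringHom_iff f q row.1.2.1 j b₀ row.1.1.toState).mp heq'
    have hmap := BaseChange.step_map f q row.1.2.1 j b₀ row.1.1.toState
    have h := hall j hj b₀ hb₀j
    unfold ireplyOK at h
    rw [Bool.or_eq_true, Bool.or_eq_true] at h
    rcases h with (h1 | h2) | h3
    · rw [Bool.not_eq_true', ← Bool.not_eq_true] at h1
      exact absurd ((isEquimultiplePoint_iff q row.1.2.1 j b₀ row.1.1).mp heq₀) h1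
    · exfalso
      apply hne
      rw [hstep, hmap]
      show MvPolynomial.map f (step q row.1.2.1 j b₀ row.1.1.toState).F = 0
      have hz : (step q row.1.2.1 j b₀ row.1.1.toState).F = 0 := by
        by_contra hnz
        have := (step_F_ne_zero_iff q row.1.2.1 j b₀ row.1.1).mp hnz
        rw [h2] at this
        exact Bool.noConfusion this
      rw [hz, map_zero]
    · obtain ⟨r, hr, hrc⟩ := exists_of_ichildIn h3
      obtain ⟨ur, hur, rfl⟩ := List.mem_map.mp hr
      change InScopeStateWins q (step q row.1.2.1 j b _)
      rw [hstep, hmap, step_toState, hrc]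
      exact hrest ur hur

/-- **SOUNDNESS OVER EVERY FIELD OF CHARACTERISTIC `p` (v2).** [folklore] -/
theorem inScopeStateWins_map_of_uiwinCertB2 {p : ℕ} [Fact p.Prime] {q : ℕ} {K : Type} [Field K] [CharP K p]
    [DecidableEq K] (f : ZMod p →+* K) :
    ∀ {T : UICert (ZMod p)}, uiwinCertB2 p q T = true →
      ∀ row ∈ T, InScopeStateWins q
        (⟨MvPolynomial.map f row.1.1.toState.F, row.1.1.toState.r, row.1.1.toState.exc⟩ : State K)
  | [], _ => fun row hrow => absurd hrow List.not_mem_nil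
  | row :: rest, h => by
    unfold uiwinCertB2 at h
    rw [Bool.and_eq_true] at h
    have hrest := inScopeStateWins_map_of_uiwinCertB2 f h.2
    intro r hr
    rcases List.mem_cons.mp hr with rfl | hr'
    · exact inScopeStateWins_map_of_uirowOK2 f hrest h.1
    · exact hrest r hr'

/-- **`∀ K` form (v2).** [folklore] -/
theorem forall_inScopeStateWins_of_uiwinCertB2 {p : ℕ} [Fact p.Prime] {q : ℕ} {T : UICert (ZMod p)}
    (h : uiwinCertB2 p q T = true) (K : Type) [Field K] [CharP K p] [DecidableEq K] :
    ∀ row ∈ T, InScopeStateWins q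
      (⟨MvPolynomial.map (ZMod.castHom (dvd_refl p) K) row.1.1.toState.F, row.1.1.toState.r,
        row.1.1.toState.exc⟩ : State K) :=
  inScopeStateWins_map_of_uiwinCertB2 (ZMod.castHom (dvd_refl p) K) h

/-! ## 4. Acceptance: the band root `x₂x₃x₄` over every field of characteristic 2 -/

/-- The band root `x₂x₃x₄` (`r = 0`, `exc = ∅`): A plays the plane `V(x₂,x₃)`; the only equimultiple replies lead to
`x₃x₄` resp. `x₂x₄` (bookkeeping as computed), each won by one more plane; in every chart the absent variables are INERT and
the present ones are forced by the witnesses listed (found by the seat's `ratwit.py`). [folklore] -/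
def x234U : UICert (ZMod 2) :=
  [(((⟨[(![0, 1, 1, 1], 1)], ![0, 0, 0, 0], ∅⟩, {1, 2}, none)), [⟨1, 2, 1, [(![0, 0, 0, 1], [(![0, 0, 0, 0], 1), (![0, 0, 1, 0], 1)])], []⟩, ⟨1, 3, 1, [(![0, 0, 1, 0], [(![0, 0, 0, 0], 1), (![0, 0, 0, 1], 1)])], []⟩, ⟨2, 1, 1, [(![0, 0, 0, 1], [(![0, 0, 0, 0], 1), (![0, 1, 0, 0], 1)])], []⟩, ⟨2, 3, 1, [(![0, 1, 0, 0], [(![0, 0, 0, 0], 1), (![0, 0, 0, 1], 1)])], []⟩]),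
   (((⟨[(![0, 0, 1, 1], 1)], ![0, 0, 0, 0], {1}⟩, {2, 3}, none)), [⟨2, 3, 1, [(![0, 0, 0, 1], [(![0, 0, 0, 1], 1), (![0, 0, 0, 2], 1)])], []⟩, ⟨3, 2, 1, [(![0, 0, 1, 0], [(![0, 0, 1, 0], 1), (![0, 0, 2, 0], 1)])], []⟩]),
   (((⟨[(![0, 1, 0, 1], 1)], ![0, 0, 0, 0], {2}⟩, {1, 3}, none)), [⟨1, 3, 1, [(![0, 0, 0, 1], [(![0, 0, 0, 1], 1), (![0, 0, 0, 2], 1)])], []⟩, ⟨3, 1, 1, [(![0, 1, 0, 0], [(![0, 1, 0, 0], 1), (![0, 2, 0, 0], 1)])], []⟩])]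

/-- The certificate passes the v2 checker (`p = q = 2`). [folklore] -/
theorem uiwinCertB2_x234U : uiwinCertB2 2 2 x234U = true := by
  decide

/-- **Over EVERY field `K` of characteristic 2 the band root `x₂x₃x₄` is in-scope escapable** (two planes; the absent
variables inert — v1 could not certify this root). [OURS · ‖ K] [folklore] -/
theorem forall_inScopeStateWins_x234U (K : Type) [Field K] [CharP K 2] [DecidableEq K] :
    ∀ row ∈ x234U, InScopeStateWins 2
      (⟨MvPolynomial.map (ZMod.castHom (dvd_refl 2) K) row.1.1.toState.F, row.1.1.toState.r,
        row.1.1.toState.exc⟩ : State K) :=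
  forall_inScopeStateWins_of_uiwinCertB2 uiwinCertB2_x234U K

end WinCertAllFields

end Summit.ResolutionOfSingularities.ResolutionOfSingularities.Theorems.PIDim4

end
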